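import Mathlib
import Summits.Ventures.PercRepro2.Defs
import Summits.Ventures.PercRepro2.Graph
import Summits.Ventures.PercRepro2.OneColourSwitch
import Summits.Ventures.PercRepro2.M9LatticeHarris

/-!
# The Harris step on an abstract cube of colourings (blind cell PercRepro2, p3 g39,
2026-08-29; `proofs/P3-POCKETRK.md` §8′ (ii)–(iv), §10 (d): the product-lattice Harris)

A family of colourings indexed by the subsets of a finite type `ι` — for the free-block
extension of the single-`d` statement, `ι` = (the switchable free blocks) ⊕ (the free edges),
and `φ S` = the point with the blocks of `S` on the `W`-side and the free edges of `S` open —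
such that `p ~_Y q` is monotone in the index, `p ~_W q` antitone, and the complement pairs a
`Y`-connection at `Sᶜ` with a `W`-connection at `S`.  Then for every antitone non-negative
weight `H` (an indicator of a lower set times a constant),
**`Σ_S H S · σ_pq(φ S) ≤ 0`** (`sum_cube_weight_mul_sigma_pq_nonpos`): `σ_pq(φ S) = Y_S − W_S ≤
Y_S − Y_{Sᶜ}` and `Σ_S (Y_S − Y_{Sᶜ}) H S ≤ 0` is the lane's Harris on the Boolean lattice
(`M9Reduce.sum_sub_compl_mul_nonpos_of_sublattice` with `L = univ`).  No graph hypothesis enters: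
the three monotonicity facts are the whole input.  Own work; std axioms.
-/

namespace Summit.Ventures.PercRepro2

namespace NoPocket

open Finset Classical OneColourSwitch

variable {V : Type*} {E : Type*} {ι : Type*} [Fintype ι] [DecidableEq ι]
  {ends : E → Sym2 V} {p q : V}

/-- **The Harris step on a cube of colourings.** For `φ : Finset ι → Config E` with `p ~_Y q`
monotone, `p ~_W q` antitone and the complement pairing `p ~_Y q at φ Sᶜ → p ~_W q at φ S`,
and an antitone non-negative weight `H`: `Σ_S H S · σ_pq(φ S) ≤ 0`. -/
theorem sum_cube_weight_mul_sigma_pq_nonpos (φ : Finset ι → Config E)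
    (hY : ∀ S T : Finset ι, S ⊆ T → Conn ends (φ S) p q → Conn ends (φ T) p q)
    (hpair : ∀ S : Finset ι, Conn ends (φ Sᶜ) p q →
      Conn ends (OneColourSwitch.compl (φ S)) p q)
    (H : Finset ι → ℤ) (hH : Antitone H) (hH0 : ∀ S, 0 ≤ H S) :
    ∑ S : Finset ι, H S * sigma ends (φ S) p q ≤ 0 := by
  -- the monotone `Y`-indicator
  let G : Finset ι → ℤ := fun S => if Conn ends (φ S) p q then 1 else 0
  have hG : Monotone G := by
    intro S T hST
    simp only [G]
    by_cases h : Conn ends (φ S) p q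
    · rw [if_pos h, if_pos (hY S T hST h)]
    · rw [if_neg h]
      split_ifs <;> norm_num
  have key := M9Reduce.sum_sub_compl_mul_nonpos_of_sublattice
    (L := (Finset.univ : Finset (Finset ι)))
    (fun _ _ _ _ => Finset.mem_univ _) (fun _ _ _ _ => Finset.mem_univ _)
    (fun _ _ => Finset.mem_univ _) hG hH
  -- termwise: `σ_pq(φ S) = Y_S − W_S ≤ Y_S − Y_{Sᶜ}` since `W_S ≥ Y_{Sᶜ}`
  have hsig : ∀ S, sigma ends (φ S) p q ≤ G S - G Sᶜ := by
    intro S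
    have hWY : (if Conn ends (φ Sᶜ) p q then (1 : ℤ) else 0) ≤
        (if Conn ends (OneColourSwitch.compl (φ S)) p q then (1 : ℤ) else 0) := by
      by_cases h : Conn ends (φ Sᶜ) p q
      · rw [if_pos h, if_pos (hpair S h)]
      · rw [if_neg h]; split_ifs <;> norm_num
    simp only [sigma, G]
    linarith
  have h1 : ∑ S : Finset ι, H S * sigma ends (φ S) p q ≤ ∑ S : Finset ι, (G S - G Sᶜ) * H S := by
    refine Finset.sum_le_sum fun S _ => ?_
    rw [mul_comm (G S - G Sᶜ) (H S)]
    exact mul_le_mul_of_nonneg_left (hsig S) (hH0 S)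
  exact h1.trans key

end NoPocket

end Summit.Ventures.PercRepro2
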